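import Literature.NumberTheory.GaloisRepresentations.LabelledWeightsDeRhamRank
import Literature.NumberTheory.GaloisRepresentations.LabelFilDTransport
import Literature.Algebra.Module.FiltrationAdaptedBasis
import HarnessLib

/-!
# The Hodge filtration of `D(ρ)` with coefficients splits along the labels; adapted bases of `D_τ`

For a period-ring datum `𝔅` of `Γ` over `F/P` (period ring `B`, `B^Γ = F`), a coefficient field
`E ⊇ P` and an `E`-linear representation `ρ` on `M`, the invariants `D(ρ) = (M ⊗_P B)^Γ` form an
`E ⊗_P F`-module (`PeriodRingData.coeffD`, `F` acting through `B`: `PeriodRingData.baseAct`) with the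
`τ`-components `D_τ(ρ)` (`PeriodRingData.labelD`, `τ : F → E`) and the Hodge filtrations
`Fil^i D_τ = D_τ ∩ (M ⊗ Fil^i B)` (`PeriodRingData.labelFilD`), whose jumps are the labelled Hodge–Tate
weights `HT_τ(ρ)` (`PeriodRingData.labelledHodgeTateWeights`).  This file PROVES (no definition, no
named fact, no `sorry`):

* `PeriodRingData.exists_lagrange` — **Lagrange interpolation along the embeddings**: for `F/P` finite
  separable and `τ₀ : F → E` there are `α ∈ F` and `q ∈ E[X]` with `q(τ₀ α) ≠ 0` and `q(τ α) = 0` for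
  every other `P`-embedding `τ ≠ τ₀` (`α` a primitive element, `q = ∏_{τ ≠ τ₀} (X − τ α)`);
* `PeriodRingData.mem_of_sum_mem_of_forall_baseAct` — **the `τ₀`-component of a sum of
  `τ`-eigenvectors lies in every `F`-stable subspace containing the sum**: if `x_τ` is a
  `τ`-eigenvector of the `F`-action for each `τ` and `Σ_τ x_τ ∈ W` with `F · W ⊆ W`, then `x_{τ₀} ∈ W`
  (`x_{τ₀} = q(τ₀ α)⁻¹ · q(α)(Σ_τ x_τ)`, and `q(α) = q(baseAct α)` preserves `W`);
* `PeriodRingData.mem_labelFilD_of_sum_mem_coeffFilTensor`,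
  `PeriodRingData.exists_sum_labelFilD_eq` — **the Hodge filtration splits along the labels**:
  `Fil^i D(ρ) = ⊕_τ Fil^i D_τ(ρ)` (with `M ⊗ Fil^i B` as the `F`-stable subspace; the decomposition
  `D = ⊕_τ D_τ` for `E` splitting `F` is the accepted `CoeffEigen.exists_sum_eq`);
* `PeriodRingData.exists_basis_labelD_adapted` — **a basis of `D_τ` adapted to the Hodge filtration**
  (Wach's « base adaptée », the accepted `Literature.Algebra.Module.exists_basis_mem_iff_of_antitone`
  applied to the finite filtration `Fil^• D_τ`): an `E`-basis `(d_k)` of `D_τ` with weights `h_k`,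
  `d_k ∈ Fil^{h_k} D_τ`, and `v ∈ Fil^i D_τ ↔` every nonzero coordinate of `v` sits on a `d_k` with
  `h_k ≥ i`;
* `PeriodRingData.finrank_labelFilD_eq_card`, `jumpMultiset_card_le`,
  `PeriodRingData.labelledHodgeTateWeights_eq_map`, `PeriodRingData.sum_labelledHodgeTateWeights_eq` —
  in an adapted basis, **`dim_E Fil^i D_τ = #{k | i ≤ h_k}`, `HT_τ(ρ) = {h_k}_k` as a multiset, and
  `Σ HT_τ(ρ) = Σ_k h_k`**.

These are the bookkeeping steps of the computation of the labelled weights of `det ρ`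
(`HT_τ(det ρ) = {Σ HT_τ(ρ)}`, Patrikis 2019 §2.3.1/§2.7.1) carried out in the sequel files.

## References
* [Patrikis2019] S. Patrikis, *Variations on a theorem of Tate*, Mem. AMS 258 (2019), §2.3.1
  (`D = ⊕_τ e_τ D`, filtered `F ⊗ E`-modules, labelled weights).
* [Wach1996] N. Wach, *Représentations p-adiques potentiellement cristallines*, Bull. Soc. Math. France
  124 (1996), §B.2.3, proof of Prop. 2 (p. 394) (« base adaptée à la filtration »).
* [FontaineAsterisque223III] J.-M. Fontaine, *Représentations p-adiques semi-stables*, Astérisque 223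
  (1994), Exp. III §1.5.4 (the induced filtration on `D`).
* [Lang1965Algebra] S. Lang, *Algebra*, Ch. V §6 (primitive element), Ch. IV §… (Lagrange
  interpolation); standard linear algebra.
-/

noncomputable section

open scoped TensorProduct
open TensorProduct Polynomial

namespace Literature.NumberTheory.GaloisRepresentations

universe u v v' w

/-! ### Polynomial operators and invariant subspaces -/

section Poly

variable {K V : Type*} [Field K] [AddCommGroup V] [Module K V]

/-- A polynomial in an operator `T` preserves every `T`-stable subspace.
[cite: Lang1965Algebra, Ch. XIV §2 (the `K[X]`-module defined by an endomorphism)] -/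
theorem aeval_apply_mem_of_forall_mem (T : Module.End K V) (W : Submodule K V)
    (hW : ∀ w ∈ W, T w ∈ W) (q : K[X]) {w : V} (hw : w ∈ W) : Polynomial.aeval T q w ∈ W := by
  induction q using Polynomial.induction_on' with
  | add p q hp hq => rw [map_add, LinearMap.add_apply]; exact add_mem hp hq
  | monomial k c =>
    rw [Polynomial.aeval_monomial, Module.End.mul_apply, Module.algebraMap_end_apply]
    refine W.smul_mem c ?_
    induction k with
    | zero => rwa [pow_zero, Module.End.one_apply]
    | succ k ih => rw [pow_succ', Module.End.mul_apply]; exact hW _ ih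

/-- A polynomial in `T` acts on a `T`-eigenvector with eigenvalue `μ` by the scalar `q(μ)`.
[cite: Lang1965Algebra, Ch. XIV §2] -/
theorem aeval_apply_of_forall_eq_smul (T : Module.End K V) {μ : K} {x : V} (hx : T x = μ • x)
    (q : K[X]) : Polynomial.aeval T q x = q.eval μ • x := by
  induction q using Polynomial.induction_on' with
  | add p q hp hq => rw [map_add, LinearMap.add_apply, hp, hq, Polynomial.eval_add, add_smul]
  | monomial k c =>
    rw [Polynomial.aeval_monomial, Module.End.mul_apply, Module.algebraMap_end_apply,
      Polynomial.eval_monomial, mul_smul]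
    congr 1
    induction k with
    | zero => rw [pow_zero, Module.End.one_apply, pow_zero, one_smul]
    | succ k ih => rw [pow_succ', Module.End.mul_apply, ih, map_smul, hx, smul_smul, ← pow_succ]

end Poly

namespace PeriodRingData

/-! ### Lagrange interpolation along the `P`-embeddings `F → E` -/

section Lagrange

variable {P : Type v} {F : Type v'} [Field P] [Field F] [Algebra P F] {E : Type*} [Field E] [Algebra P E]
  [FiniteDimensional P F] [Algebra.IsSeparable P F]

/-- **Lagrange interpolation along the embeddings.**  For `F/P` finite separable and a `P`-embedding
`τ₀ : F → E` there are `α ∈ F` (a primitive element) and `q ∈ E[X]` (`∏_{τ ≠ τ₀} (X − τ α)`) with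
`q(τ₀ α) ≠ 0` and `q(τ α) = 0` for all `τ ≠ τ₀`: distinct embeddings take distinct values at a
primitive element. [cite: Lang1965Algebra, Ch. V §6 (primitive element theorem) and Ch. V §4 (embeddings)] -/
theorem exists_lagrange (τ₀ : F →ₐ[P] E) :
    ∃ (α : F) (q : E[X]), q.eval (τ₀ α) ≠ 0 ∧ ∀ τ : F →ₐ[P] E, τ ≠ τ₀ → q.eval (τ α) = 0 := by
  classical
  let pb := Field.powerBasisOfFiniteOfSeparable P F
  have hinj : ∀ τ : F →ₐ[P] E, τ ≠ τ₀ → τ pb.gen ≠ τ₀ pb.gen :=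
    fun τ hτ h => hτ (pb.algHom_ext h)
  refine ⟨pb.gen, ∏ τ ∈ Finset.univ.erase τ₀, (X - C (τ pb.gen)), ?_, fun τ hτ => ?_⟩
  · rw [Polynomial.eval_prod]
    refine Finset.prod_ne_zero_iff.2 fun τ hτ => ?_
    rw [Polynomial.eval_sub, Polynomial.eval_X, Polynomial.eval_C]
    exact sub_ne_zero.2 (hinj τ (Finset.ne_of_mem_erase hτ)).symm
  · rw [Polynomial.eval_prod]
    exact Finset.prod_eq_zero (Finset.mem_erase.2 ⟨hτ, Finset.mem_univ τ⟩)
      (by rw [Polynomial.eval_sub, Polynomial.eval_X, Polynomial.eval_C, sub_self])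

end Lagrange

/-! ### The `τ₀`-component of a sum of eigenvectors -/

section Component

-- Mathlib's own global value of `maxSynthPendingDepth` (see `LabelledWeightsTwist`).
set_option maxSynthPendingDepth 3

variable {Γ : Type u} [Group Γ] [TopologicalSpace Γ] {P : Type v} {F : Type v'} [Field P] [Field F]
  [Algebra P F] {E : Type*} [Field E] [Algebra P E] [TopologicalSpace E]
  {M : Type*} [AddCommGroup M] [Module E M] [Module P M] [IsScalarTower P E M] [TopologicalSpace M]
  (𝔅 : PeriodRingData.{u, v, v', w} Γ P F)

omit [TopologicalSpace Γ] [TopologicalSpace E] [TopologicalSpace M] in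
/-- **The `τ₀`-component of a sum of `τ`-eigenvectors lies in every `F`-stable subspace containing the
sum.**  If `x_τ ∈ M ⊗_P B` satisfies `f · x_τ = τ(f) x_τ` for all `f ∈ F` (each `τ : F → E`), `W` is an
`E`-subspace with `F · W ⊆ W`, and `Σ_τ x_τ ∈ W`, then `x_{τ₀} ∈ W` — by Lagrange interpolation:
`q(α) (Σ_τ x_τ) = q(τ₀ α) x_{τ₀}` for the polynomial of `exists_lagrange`, and `q(α)` preserves `W`.
[cite: Patrikis2019, §2.3.1 (`D = ⊕_τ e_τ D` as filtered modules)] -/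
theorem mem_of_sum_mem_of_forall_baseAct [FiniteDimensional P F] [Algebra.IsSeparable P F]
    (W : Submodule E (M ⊗[P] 𝔅.B)) (hW : ∀ (f : F), ∀ w ∈ W, 𝔅.baseAct E M f w ∈ W)
    (x : (F →ₐ[P] E) → M ⊗[P] 𝔅.B) (hx : ∀ (τ : F →ₐ[P] E) (f : F), 𝔅.baseAct E M f (x τ) = τ f • x τ)
    (hsum : ∑ τ, x τ ∈ W) (τ₀ : F →ₐ[P] E) : x τ₀ ∈ W := by
  classical
  obtain ⟨α, q, hq₀, hq⟩ := exists_lagrange (E := E) τ₀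
  set T : Module.End E (M ⊗[P] 𝔅.B) := 𝔅.baseActAlgHom E M α with hT
  have hTx : ∀ τ : F →ₐ[P] E, T (x τ) = τ α • x τ := fun τ => by
    rw [hT, baseActAlgHom_apply, hx]
  have key : Polynomial.aeval T q (∑ τ, x τ) = q.eval (τ₀ α) • x τ₀ := by
    rw [map_sum, Finset.sum_eq_single τ₀]
    · exact aeval_apply_of_forall_eq_smul T (hTx τ₀) q
    · intro τ _ hτ
      rw [aeval_apply_of_forall_eq_smul T (hTx τ) q, hq τ hτ, zero_smul]
    · intro h; exact absurd (Finset.mem_univ τ₀) h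
  have hmem : Polynomial.aeval T q (∑ τ, x τ) ∈ W :=
    aeval_apply_mem_of_forall_mem T W (fun w hw => by rw [hT, baseActAlgHom_apply]; exact hW α w hw)
      q hsum
  rw [key] at hmem
  have h := W.smul_mem (q.eval (τ₀ α))⁻¹ hmem
  rwa [smul_smul, inv_mul_cancel₀ hq₀, one_smul] at h

omit [TopologicalSpace Γ] [TopologicalSpace E] [TopologicalSpace M] in
/-- **`M ⊗ Fil^i B` is `F`-stable** (`F ⊆ Fil⁰ B` and the filtration is multiplicative).
[cite: FontaineAsterisque223III, Exp. III §1.5.4] -/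
theorem baseAct_mem_coeffFilTensor (f : F) {i : ℤ} {x : M ⊗[P] 𝔅.B}
    (hx : x ∈ 𝔅.coeffFilTensor E M i) : 𝔅.baseAct E M f x ∈ 𝔅.coeffFilTensor E M i := by
  refine 𝔅.coeffFilTensor_induction (E := E) (M := M) (C := fun x => 𝔅.baseAct E M f x ∈ 𝔅.coeffFilTensor E M i)
    ?_ (fun m b hb => ?_) (fun y z hy hz => ?_) hx
  · rw [map_zero]; exact zero_mem _
  · rw [baseAct_tmul]; exact 𝔅.tmul_mem_coeffFilTensor _ ((𝔅.fil i).smul_mem f hb)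
  · rw [map_add]; exact add_mem hy hz

variable (ρ : ContinuousRep Γ E M)

/-- **The Hodge filtration splits along the labels (membership form).**  If `x_τ ∈ D_τ(ρ)` for every
`τ : F → E` and `Σ_τ x_τ ∈ M ⊗ Fil^i B`, then each `x_τ ∈ Fil^i D_τ(ρ)`.
[cite: Patrikis2019, §2.3.1] [cite: FontaineAsterisque223III, Exp. III §1.5.4] -/
theorem mem_labelFilD_of_sum_mem_coeffFilTensor [FiniteDimensional P F] [Algebra.IsSeparable P F]
    (x : (F →ₐ[P] E) → M ⊗[P] 𝔅.B) (hx : ∀ τ : F →ₐ[P] E, x τ ∈ 𝔅.labelD ρ τ.toRingHom) {i : ℤ}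
    (hsum : ∑ τ, x τ ∈ 𝔅.coeffFilTensor E M i) (τ₀ : F →ₐ[P] E) :
    x τ₀ ∈ 𝔅.labelFilD ρ τ₀.toRingHom i := by
  refine Submodule.mem_inf.2 ⟨hx τ₀, ?_⟩
  exact 𝔅.mem_of_sum_mem_of_forall_baseAct (𝔅.coeffFilTensor E M i)
    (fun f w hw => 𝔅.baseAct_mem_coeffFilTensor f hw) x (fun τ f => (hx τ).2 f) hsum τ₀

/-- **`Fil^i D(ρ) = ⊕_τ Fil^i D_τ(ρ)`** for `E` splitting `F`: every `y ∈ D(ρ) ∩ (M ⊗ Fil^i B)` is a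
sum `Σ_τ y_τ` with `y_τ ∈ Fil^i D_τ(ρ)` (the decomposition `D = ⊕_τ D_τ` is the accepted
`CoeffEigen.exists_sum_eq`; each component stays in `M ⊗ Fil^i B` by
`mem_labelFilD_of_sum_mem_coeffFilTensor`). [cite: Patrikis2019, §2.3.1] -/
theorem exists_sum_labelFilD_eq [FiniteDimensional P F] [Algebra.IsSeparable P F]
    (hsplit : Fintype.card (F →ₐ[P] E) = Module.finrank P F) {i : ℤ} {y : M ⊗[P] 𝔅.B}
    (hyD : y ∈ 𝔅.coeffD ρ) (hyF : y ∈ 𝔅.coeffFilTensor E M i) :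
    ∃ x : (F →ₐ[P] E) → M ⊗[P] 𝔅.B, (∀ τ, x τ ∈ 𝔅.labelFilD ρ τ.toRingHom i) ∧ ∑ τ, x τ = y := by
  classical
  obtain ⟨z, hz, hsum⟩ :=
    CoeffEigen.exists_sum_eq (U := 𝔅.coeffD ρ) (𝔅.coeffDAct ρ) hsplit (⟨y, hyD⟩ : 𝔅.coeffD ρ)
  have hy : ∑ τ, ((z τ : 𝔅.coeffD ρ) : M ⊗[P] 𝔅.B) = y := by
    rw [← Submodule.coe_sum, hsum]
  refine ⟨fun τ => ((z τ : 𝔅.coeffD ρ) : M ⊗[P] 𝔅.B), fun τ => ?_, hy⟩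
  refine 𝔅.mem_labelFilD_of_sum_mem_coeffFilTensor ρ _
    (fun τ' => (𝔅.mem_eigenSub_coeffDAct_iff ρ τ' _).1 (hz τ')) ?_ τ
  rw [hy]; exact hyF

end Component

/-! ### Bases of `D_τ` adapted to the Hodge filtration; the weights as a map -/

section Adapted

-- Mathlib's own global value of `maxSynthPendingDepth` (see `LabelledWeightsTwist`).
set_option maxSynthPendingDepth 3

variable {Γ : Type u} [Group Γ] [TopologicalSpace Γ] {P : Type v} {F : Type v'} [Field P] [Field F]
  [Algebra P F] {E : Type*} [Field E] [Algebra P E] [TopologicalSpace E]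
  {M : Type*} [AddCommGroup M] [Module E M] [Module P M] [IsScalarTower P E M] [TopologicalSpace M]
  (𝔅 : PeriodRingData.{u, v, v', w} Γ P F) (ρ : ContinuousRep Γ E M) (τ : F →+* E)

/-- **A basis of `D_τ(ρ)` adapted to the Hodge filtration** (Wach: « base adaptée à la filtration »).
For `D_τ` finite-dimensional there are an `E`-basis `(d_k)_{k<m}` of `D_τ` and weights `h_k ∈ ℤ` with
`d_k ∈ Fil^{h_k} D_τ` such that, for every `i` and `v ∈ D_τ`: **`v ∈ Fil^i D_τ ↔` every nonzero
coordinate of `v` sits on a `d_k` with `i ≤ h_k`**, i.e. `Fil^i D_τ = ⊕_{h_k ≥ i} E d_k`.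
[cite: Wach1996, §B.2.3, proof of Prop. 2 (p. 394)] [cite: Patrikis2019, §2.3.1] -/
theorem exists_basis_labelD_adapted [FiniteDimensional E (𝔅.labelD ρ τ)] :
    ∃ (m : ℕ) (d : Module.Basis (Fin m) E (𝔅.labelD ρ τ)) (h : Fin m → ℤ),
      (∀ k, (d k : M ⊗[P] 𝔅.B) ∈ 𝔅.labelFilD ρ τ (h k)) ∧
      ∀ (i : ℤ) (v : 𝔅.labelD ρ τ),
        (v : M ⊗[P] 𝔅.B) ∈ 𝔅.labelFilD ρ τ i ↔ ∀ k, d.repr v k ≠ 0 → i ≤ h k := by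
  set N : ℤ → Submodule E (𝔅.labelD ρ τ) := fun i => (𝔅.labelFilD ρ τ i).comap (𝔅.labelD ρ τ).subtype
    with hN
  have hNanti : Antitone N := fun i j hij v hv => 𝔅.labelFilD_antitone ρ τ hij hv
  obtain ⟨a, ha⟩ := 𝔅.exists_labelFilD_eq_labelD ρ τ
  obtain ⟨b, hb⟩ := 𝔅.exists_labelFilD_eq_bot ρ τ
  have hNa : N a = ⊤ := by
    rw [hN]
    exact Submodule.comap_subtype_eq_top.2 (le_of_eq ha.symm)
  have hNb : N b = ⊥ := by
    rw [hN]
    simp only [hb, Submodule.comap_bot, Submodule.ker_subtype]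
  obtain ⟨m, d, h, -, hdh, hiff⟩ :=
    Literature.Algebra.Module.exists_basis_mem_iff_of_antitone N hNanti hNa hNb
  exact ⟨m, d, h, hdh, fun i v => hiff i v⟩

variable {𝔅 ρ τ}

/-- **In an adapted basis, `Fil^i D_τ` is spanned by the `d_k` with `i ≤ h_k`**, so
`dim_E Fil^i D_τ = #{k | i ≤ h_k}`. [cite: Wach1996, §B.2.3, proof of Prop. 2 (p. 394)] -/
theorem finrank_labelFilD_eq_card {m : ℕ} (d : Module.Basis (Fin m) E (𝔅.labelD ρ τ)) (h : Fin m → ℤ)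
    (hiff : ∀ (i : ℤ) (v : 𝔅.labelD ρ τ),
      (v : M ⊗[P] 𝔅.B) ∈ 𝔅.labelFilD ρ τ i ↔ ∀ k, d.repr v k ≠ 0 → i ≤ h k) (i : ℤ) :
    Module.finrank E (𝔅.labelFilD ρ τ i) = (Finset.univ.filter fun k => i ≤ h k).card := by
  classical
  set N : Submodule E (𝔅.labelD ρ τ) := (𝔅.labelFilD ρ τ i).comap (𝔅.labelD ρ τ).subtype with hN
  -- `N = span (d '' S)` with `S = {k | i ≤ h k}`
  set S : Set (Fin m) := {k | i ≤ h k} with hS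
  have hNspan : N = Submodule.span E (d '' S) := by
    ext v
    rw [Module.Basis.mem_span_image, hN, Submodule.mem_comap, Submodule.subtype_apply, hiff]
    simp only [hS, Set.subset_def, Finset.mem_coe, Finsupp.mem_support_iff, Set.mem_setOf_eq]
  have h1 : Module.finrank E (𝔅.labelFilD ρ τ i) = Module.finrank E N :=
    (Submodule.comapSubtypeEquivOfLe (𝔅.labelFilD_le ρ τ i)).symm.finrank_eq
  rw [h1, hNspan, Set.image_eq_range, finrank_span_eq_card]
  · rw [Fintype.card_of_subtype (Finset.univ.filter fun k => i ≤ h k)]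
    intro k
    simp only [Finset.mem_filter, Finset.mem_univ, true_and, hS, Set.mem_setOf_eq]
  · exact d.linearIndependent.comp _ Subtype.val_injective

end Adapted

end PeriodRingData

/-! ### The jump multiset of a counting function -/

section Jump

/-- **The jump multiset of `i ↦ #{k | i ≤ h_k}` is the multiset of values `{h_k}_k`.**
[cite: Patrikis2019, §2.3.1 (multiplicities `dim gr^h`)] -/
theorem jumpMultiset_card_le {m : ℕ} (h : Fin m → ℤ) :
    jumpMultiset (fun i => (Finset.univ.filter fun k => i ≤ h k).card) =
      Finset.univ.val.map h := by
  classical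
  set d : ℤ → ℕ := fun i => (Finset.univ.filter fun k => i ≤ h k).card with hd
  -- the difference `d i - d (i + 1)` counts the `k` with `h k = i`
  have hsub : ∀ i, (Finset.univ.filter fun k => i + 1 ≤ h k) ⊆ Finset.univ.filter fun k => i ≤ h k :=
    fun i k hk => by
      simp only [Finset.mem_filter, Finset.mem_univ, true_and] at hk ⊢
      omega
  have hdiff : ∀ i, d i - d (i + 1) = (Finset.univ.filter fun k => i = h k).card := by
    intro i
    rw [hd]
    simp only
    rw [← Finset.card_sdiff_of_subset (hsub i)]
    congr 1
    ext k
    simp only [Finset.mem_sdiff, Finset.mem_filter, Finset.mem_univ, true_and, not_le]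
    omega
  -- the set of jumps is finite (contained in the image of `h`)
  have hfin : {i : ℤ | d (i + 1) < d i}.Finite := by
    refine (Finset.finite_toSet (Finset.univ.image h)).subset fun i hi => ?_
    simp only [Set.mem_setOf_eq] at hi
    have hpos : 0 < d i - d (i + 1) := Nat.sub_pos_of_lt hi
    rw [hdiff, Finset.card_pos] at hpos
    obtain ⟨k, hk⟩ := hpos
    simp only [Finset.mem_filter, Finset.mem_univ, true_and] at hk
    exact Finset.mem_coe.2 (Finset.mem_image.2 ⟨k, Finset.mem_univ k, hk.symm⟩)
  ext a
  rw [count_jumpMultiset hfin, hdiff, Multiset.count_map]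
  rw [← Finset.filter_val, Finset.card_val]

/-- The sum of the jump multiset of `i ↦ #{k | i ≤ h_k}` is `Σ_k h_k`. [cite: Patrikis2019, §2.3.1] -/
theorem sum_jumpMultiset_card_le {m : ℕ} (h : Fin m → ℤ) :
    (jumpMultiset (fun i => (Finset.univ.filter fun k => i ≤ h k).card)).sum = ∑ k, h k := by
  rw [jumpMultiset_card_le, Finset.sum_eq_multiset_sum]

end Jump

namespace PeriodRingData

section Weights

-- Mathlib's own global value of `maxSynthPendingDepth` (see `LabelledWeightsTwist`).
set_option maxSynthPendingDepth 3

variable {Γ : Type u} [Group Γ] [TopologicalSpace Γ] {P : Type v} {F : Type v'} [Field P] [Field F]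
  [Algebra P F] {E : Type*} [Field E] [Algebra P E] [TopologicalSpace E]
  {M : Type*} [AddCommGroup M] [Module E M] [Module P M] [IsScalarTower P E M] [TopologicalSpace M]
  {𝔅 : PeriodRingData.{u, v, v', w} Γ P F} {ρ : ContinuousRep Γ E M} {τ : F →+* E}

/-- **`HT_τ(ρ) = {h_k}_k`** (as a multiset) for a basis of `D_τ(ρ)` adapted to the Hodge filtration
with weights `h_k`. [cite: Patrikis2019, §2.3.1] [cite: Wach1996, §B.2.3, proof of Prop. 2 (p. 394)] -/
theorem labelledHodgeTateWeights_eq_map {m : ℕ} (d : Module.Basis (Fin m) E (𝔅.labelD ρ τ))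
    (h : Fin m → ℤ)
    (hiff : ∀ (i : ℤ) (v : 𝔅.labelD ρ τ),
      (v : M ⊗[P] 𝔅.B) ∈ 𝔅.labelFilD ρ τ i ↔ ∀ k, d.repr v k ≠ 0 → i ≤ h k) :
    𝔅.labelledHodgeTateWeights ρ τ = Finset.univ.val.map h := by
  rw [labelledHodgeTateWeights_def, ← jumpMultiset_card_le h]
  congr 1
  funext i
  exact finrank_labelFilD_eq_card d h hiff i

/-- **`Σ HT_τ(ρ) = Σ_k h_k`** for a basis of `D_τ(ρ)` adapted to the Hodge filtration with weights `h_k`.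
[cite: Patrikis2019, §2.3.1] -/
theorem sum_labelledHodgeTateWeights_eq {m : ℕ} (d : Module.Basis (Fin m) E (𝔅.labelD ρ τ))
    (h : Fin m → ℤ)
    (hiff : ∀ (i : ℤ) (v : 𝔅.labelD ρ τ),
      (v : M ⊗[P] 𝔅.B) ∈ 𝔅.labelFilD ρ τ i ↔ ∀ k, d.repr v k ≠ 0 → i ≤ h k) :
    (𝔅.labelledHodgeTateWeights ρ τ).sum = ∑ k, h k := by
  rw [labelledHodgeTateWeights_eq_map d h hiff, Finset.sum_eq_multiset_sum]

/-- **`card HT_τ(ρ) = m`** (the size of an adapted basis, i.e. `dim_E D_τ`). [cite: Patrikis2019, §2.3.1] -/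
theorem card_labelledHodgeTateWeights_eq_of_adapted {m : ℕ} (d : Module.Basis (Fin m) E (𝔅.labelD ρ τ))
    (h : Fin m → ℤ)
    (hiff : ∀ (i : ℤ) (v : 𝔅.labelD ρ τ),
      (v : M ⊗[P] 𝔅.B) ∈ 𝔅.labelFilD ρ τ i ↔ ∀ k, d.repr v k ≠ 0 → i ≤ h k) :
    Multiset.card (𝔅.labelledHodgeTateWeights ρ τ) = m := by
  rw [labelledHodgeTateWeights_eq_map d h hiff, Multiset.card_map, Finset.card_val,
    Finset.card_univ, Fintype.card_fin]

end Weights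

end PeriodRingData

end Literature.NumberTheory.GaloisRepresentations

end
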